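import Mathlib.GroupTheory.Perm.Fin
import Literature.AnabelianGeometry.SemiGraphs.PSCSeparatingCoveringsIrreducibleNodal
import HarnessLib

/-!
# [CombGC] Prop. 1.2 at IRREDUCIBLE ONE-NODAL data with TWO cusps: the edge-like third by non-abelian characters

Mochizuki, *A combinatorial version of the Grothendieck conjecture*, Tohoku Math. J. **59** (2007) [CombGC]
§1, PROOF of Proposition 1.2, p. 9 (separating coverings "by gluing together appropriate finite étale
coverings of the anabelioids `G_v`, `G_e`") [cite: MochizukiCombGC2007, Prop 1.2 proof p.9] and Prop. 1.2
(i)(ii) p. 8 [cite: MochizukiCombGC2007, Prop 1.2 pp.8-9]; typed LEVEL-WISE by abc-iut-w4-d081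
(`PSCDatum.EdgeLikeSeparatingCoverings`, row P12-L01-E / FACT row F-2827; universal closure refuted, instance
forms the content).

PROOF-ONLY sequel (abc-iut-w5-d174 gen 6) of `PSCSeparatingCoveringsIrreducibleNodal.lean`, which proved
F-2827 at abc-iut-f-164's irreducible one-nodal carrier (`Δ_irr`; `ι : Γ_{g,·} → Π` a profinite pro-`Σ`
completion, node `cl ι⟨b_0⟩`, cusps `cl ι⟨c_j⟩`) for AT LEAST THREE cusps: with `ℤ/3`-characters the pair
"`c_j` alive, `c_k` killed" needs a third cusp to absorb the weight (`∑_j χ(c_j) = 0`).  Here the separating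
homomorphisms are taken in the NON-ABELIAN finite group `ℤ/3 × 𝔖₃` and built directly on the presentation
(`PresentedGroup.toGroup`, `lift_relator`): for "`c_j` alive, `c_k` killed" send `a_0 ↦ x`, `b_0 ↦ y`,
`c_j ↦ [x,y]⁻¹` and every other generator to `1` — the relator `∏[a_i,b_i]·∏ c_j` goes to `[x,y][x,y]⁻¹ = 1`,
`c_k ↦ 1`, `c_j ↦ [x,y]⁻¹ ≠ 1`.  No third cusp is used, so:

* `edgeLikeSeparatingCoverings_of_irreducibleNodal_twoCusps` — **F-2827 at EVERY irreducible one-nodal datum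
  with at least TWO cusps** (`Γ_{g,r+2}`, `g ≥ 1`), via abc-iut-f-164's
  `edgeLikeSeparatingCoverings_of_rankOneFreeFactors`;
* `separatingCoverings_of_irreducibleNodal_twoCusps`, `prop12_of_irreducibleNodal_twoCusps` — F-2829 (all three
  conjuncts; F-2826 from the parent file, F-2828 abc-iut-f-164) and ALL FIVE typed clauses of Prop. 1.2 (i)(ii)
  at every such datum; `exists_irreducibleNodalDatum_prop12_twoCusps` — non-vacuity at the genuine pro-`Σ`
  datum of `Γ_{1,2}`.

HONEST SCOPE: one cusp (`c_0 ∈ [Γ,Γ]` is in no free basis) and `Γ_{g,0}` are not treated.  A shape instance is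
consistency evidence for the typed schemata, not the printed theorem for all pointed stable curves (cell
FOUNDATIONS rows 13–14).  0 definitions; nothing here takes a side on [IUTchIII] Cor. 3.12.
-/

noncomputable section

open scoped Pointwise

namespace Literature.AnabelianGeometry.SemiGraphs

namespace PSCDatum

open Literature.GroupTheory.CombinatorialGroupTheory
open Literature.GroupTheory.CombinatorialGroupTheory.PuncturedSurfaceGroup (a b c cuspInertia relator
  lift_relator exists_freeGroupBasis_elim_zero exists_freeGroupBasis_eq_c exists_handleCuspCharacter)
open SemiGraphOfAnabelioids (IsProSigmaCompletion)
open TwoComponentAffine (sum_twoDelta)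
open Multiplicative

variable {P : Type} [Group P] [TopologicalSpace P] [IsTopologicalGroup P]
variable [CompactSpace P] [TotallyDisconnectedSpace P] {Sigma : Set ℕ} {g r : ℕ}

/-! ### Bookkeeping: one-entry list products, the non-abelian target -/

/-- A product over a duplicate-free list whose only non-unit entry sits at `k` is that entry.
[cite: MochizukiCombGC2007, Prop 1.2 proof p.9] -/
private theorem prod_map_ite_eq_single {M : Type*} [Monoid M] {α : Type*} [DecidableEq α] (x : M) (k : α) :
    ∀ (l : List α), l.Nodup → k ∈ l → (l.map fun i => if i = k then x else 1).prod = x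
  | [], _, hk => absurd hk (by simp)
  | a :: l, hl, hk => by
    rw [List.nodup_cons] at hl
    rw [List.map_cons, List.prod_cons]
    by_cases ha : a = k
    · subst ha
      rw [if_pos rfl]
      have h1 : (l.map fun i => if i = a then x else 1).prod = 1 := by
        refine List.prod_eq_one fun y hy => ?_
        obtain ⟨i, hi, rfl⟩ := List.mem_map.mp hy
        rw [if_neg]
        rintro rfl
        exact hl.1 hi
      rw [h1, mul_one]
    · rw [if_neg ha, one_mul]
      exact prod_map_ite_eq_single x k l hl.2 ((List.mem_cons.mp hk).resolve_left (Ne.symm ha))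

/-- The two transpositions `(0 1)`, `(1 2)` of `𝔖₃` do not commute: their commutator is `≠ 1`.
[cite: MochizukiCombGC2007, Prop 1.2 proof p.9] -/
private theorem swap_comm_ne_one :
    (Equiv.swap (0 : Fin 3) 1 * Equiv.swap (1 : Fin 3) 2 * (Equiv.swap (0 : Fin 3) 1)⁻¹ *
      (Equiv.swap (1 : Fin 3) 2)⁻¹ : Equiv.Perm (Fin 3)) ≠ 1 := by
  decide

/-- **The non-abelian cusp character.**  For `g ≥ 1` and a cusp index `j₀` there is a homomorphism
`ρ : Γ_{g,n} → 𝔖₃` with `ρ(c_{j₀}) = [x,y]⁻¹ ≠ 1`, `ρ(c_k) = 1` for `k ≠ j₀`, and `ρ(b_0) = y` — namely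
`a_0 ↦ x = (0 1)`, `b_0 ↦ y = (1 2)`, `c_{j₀} ↦ [x,y]⁻¹`, all other generators `↦ 1`; the relator
`∏[a_i,b_i]·∏_k c_k` goes to `[x,y]·[x,y]⁻¹ = 1`. [cite: MochizukiCombGC2007, Prop 1.2 proof p.9] -/
theorem exists_nonabelian_cuspCharacter {n : ℕ} (hg : 1 ≤ g) (j₀ : Fin n) :
    ∃ ρ : PuncturedSurfaceGroup g n →* Equiv.Perm (Fin 3),
      ρ (c j₀) ≠ 1 ∧ (∀ k : Fin n, k ≠ j₀ → ρ (c k) = 1) := by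
  classical
  set x : Equiv.Perm (Fin 3) := Equiv.swap 0 1 with hx
  set y : Equiv.Perm (Fin 3) := Equiv.swap 1 2 with hy
  set z : Equiv.Perm (Fin 3) := x * y * x⁻¹ * y⁻¹ with hz
  have hz1 : z ≠ 1 := by rw [hz, hx, hy]; exact swap_comm_ne_one
  let f : puncturedSurfaceGen g n → Equiv.Perm (Fin 3) :=
    Sum.elim (fun p => if p.1 = ⟨0, hg⟩ then (bif p.2 then y else x) else 1)
      fun k => if k = j₀ then z⁻¹ else 1
  have hfa : ∀ i : Fin g, f (Sum.inl (i, false)) = if i = ⟨0, hg⟩ then x else 1 := fun i => rfl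
  have hfb : ∀ i : Fin g, f (Sum.inl (i, true)) = if i = ⟨0, hg⟩ then y else 1 := fun i => rfl
  have hfc : ∀ k : Fin n, f (Sum.inr k) = if k = j₀ then z⁻¹ else 1 := fun k => rfl
  have hrel : ∀ w ∈ ({relator g n} : Set (FreeGroup (puncturedSurfaceGen g n))), FreeGroup.lift f w = 1 := by
    intro w hw
    rw [Set.mem_singleton_iff] at hw
    subst hw
    rw [lift_relator]
    have h1 : ((List.finRange g).map fun i =>
        f (Sum.inl (i, false)) * f (Sum.inl (i, true)) * (f (Sum.inl (i, false)))⁻¹ *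
          (f (Sum.inl (i, true)))⁻¹).prod = z := by
      have hfun : (fun i : Fin g => f (Sum.inl (i, false)) * f (Sum.inl (i, true)) *
          (f (Sum.inl (i, false)))⁻¹ * (f (Sum.inl (i, true)))⁻¹) =
          fun i => if i = ⟨0, hg⟩ then z else 1 := by
        funext i
        rw [hfa, hfb]
        split_ifs with h
        · rfl
        · simp
      rw [hfun]
      exact prod_map_ite_eq_single z ⟨0, hg⟩ _ (List.nodup_finRange g) (List.mem_finRange _)
    have h2 : ((List.finRange n).map fun k => f (Sum.inr k)).prod = z⁻¹ := by
      have hfun : (fun k : Fin n => f (Sum.inr k)) = fun k => if k = j₀ then z⁻¹ else 1 := funext hfc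
      rw [hfun]
      exact prod_map_ite_eq_single z⁻¹ j₀ _ (List.nodup_finRange n) (List.mem_finRange _)
    rw [h1, h2, mul_inv_cancel]
  refine ⟨PresentedGroup.toGroup hrel, ?_, fun k hk => ?_⟩
  · change PresentedGroup.toGroup hrel (PresentedGroup.of (Sum.inr j₀)) ≠ 1
    rw [PresentedGroup.toGroup.of, hfc, if_pos rfl]
    exact inv_ne_one.mpr hz1
  · change PresentedGroup.toGroup hrel (PresentedGroup.of (Sum.inr k)) = 1
    rw [PresentedGroup.toGroup.of, hfc, if_neg hk]

/-- `ofAdd 1 ≠ 1` in `ℤ/3`. [cite: MochizukiCombGC2007, Prop 1.2 proof p.9] -/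
private theorem ofAdd_one_ne_one₃'' : (ofAdd (1 : ZMod 3) : Multiplicative (ZMod 3)) ≠ 1 := by
  intro h
  have h1 : (1 : ZMod 3) = 0 := Multiplicative.ofAdd.injective (h.trans ofAdd_zero.symm)
  exact absurd h1 (by decide)

/-- With two indices available there is one different from a given one.
[cite: MochizukiCombGC2007, Prop 1.2 proof p.9] -/
private theorem exists_ne'' {n : ℕ} (hn : 2 ≤ n) (k : Fin n) : ∃ m : Fin n, m ≠ k := by
  by_cases hk : (k : ℕ) = 0
  · exact ⟨⟨1, by omega⟩, fun h => by have := congrArg Fin.val h; simp only at this; omega⟩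
  · exact ⟨⟨0, by omega⟩, fun h => by have := congrArg Fin.val h; simp only at this; omega⟩

/-! ### F-2827 with two cusps -/

/-- **Row P12-L01-E / F-2827 (`EdgeLikeSeparatingCoverings`) at EVERY irreducible one-nodal datum with at
least TWO cusps.**  As in the parent file the node loop `b_0` and every `c_j` are members of free bases, so
abc-iut-f-164's `edgeLikeSeparatingCoverings_of_rankOneFreeFactors` applies — now with characters into
`ℤ/3 × 𝔖₃`: the `ℤ/3`-characters `b_0^∨` (alive node) and `δ_k − δ_m` (alive cusp, killed node) in the first
factor, and the non-abelian cusp character `exists_nonabelian_cuspCharacter` (alive `c_j`, killed `c_k`) in the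
second. [cite: MochizukiCombGC2007, Prop 1.2 proof p.9] -/
theorem edgeLikeSeparatingCoverings_of_irreducibleNodal_twoCusps (hne : Sigma.Nonempty)
    (hprime : ∀ p ∈ Sigma, p.Prime) (ι : PuncturedSurfaceGroup g (r + 2) →* P)
    (hι : IsProSigmaCompletion Sigma ι) (G : PSCDatum P) (hg : 1 ≤ g) (e : G.graph.C ≃ Fin (r + 2))
    (hC : ∀ c', G.cuspGp c' = ((cuspInertia (g := g) (e c')).map ι).topologicalClosure)
    (n₀ : G.graph.N) (hN : ∀ n, n = n₀)
    (hE : G.nodeGp n₀ = ((Subgroup.zpowers (PuncturedSurfaceGroup.b (r := r + 2) (⟨0, hg⟩ : Fin g))).map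
      ι).topologicalClosure) :
    G.EdgeLikeSeparatingCoverings := by
  classical
  have hSig : ∃ ℓ ∈ Sigma, ℓ.Prime := hne.imp fun p hp => ⟨hp, hprime p hp⟩
  obtain ⟨b₀, -, hbb, -⟩ := exists_freeGroupBasis_elim_zero g (r + 1)
  -- generators of the edge groups
  let xs : G.graph.N ⊕ G.graph.C → PuncturedSurfaceGroup g (r + 2) :=
    Sum.elim (fun _ => b ⟨0, hg⟩) fun c' => c (e c')
  have hxn : ∀ n, xs (Sum.inl n) = b ⟨0, hg⟩ := fun _ => rfl
  have hxc : ∀ c', xs (Sum.inr c') = c (e c') := fun _ => rfl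
  have hx : ∀ e', G.edgeGp e' = ((Subgroup.zpowers (xs e')).map ι).topologicalClosure := by
    rintro (n | c')
    · change G.nodeGp n = _
      rw [hN n, hE, hxn]
    · exact hC c'
  have hfac : ∀ e', ∃ (κ : Type) (bκ : FreeGroupBasis κ (PuncturedSurfaceGroup g (r + 2))) (k : κ),
      bκ k = xs e' := by
    rintro (n | c')
    · exact ⟨_, b₀, Sum.inl (⟨0, hg⟩, true), by rw [hxn]; exact hbb _⟩
    · obtain ⟨β, bs, k, hk⟩ := exists_freeGroupBasis_eq_c (g := g) (by omega : 2 ≤ r + 2) (e c')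
      exact ⟨β, bs, k, hk⟩
  -- the separating homomorphisms into `ℤ/3 × 𝔖₃`
  have hinl : ∀ u : Multiplicative (ZMod 3),
      (MonoidHom.inl (Multiplicative (ZMod 3)) (Equiv.Perm (Fin 3)) u = 1 ↔ u = 1) := fun u => by
    rw [MonoidHom.inl_apply, Prod.mk_eq_one, and_iff_left rfl]
  have hinr : ∀ u : Equiv.Perm (Fin 3),
      (MonoidHom.inr (Multiplicative (ZMod 3)) (Equiv.Perm (Fin 3)) u = 1 ↔ u = 1) := fun u => by
    rw [MonoidHom.inr_apply, Prod.mk_eq_one, and_iff_right rfl]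
  have hsep : ∀ e₁ e₂, e₁ ≠ e₂ →
      ∃ χ : PuncturedSurfaceGroup g (r + 2) →* Multiplicative (ZMod 3) × Equiv.Perm (Fin 3),
        χ (xs e₂) = 1 ∧ χ (xs e₁) ≠ 1 := by
    rintro (n₁ | c₁) (n₂ | c₂) hne12
    · exact absurd (by rw [hN n₁, hN n₂]) hne12
    · -- alive node `b_0`, killed cusp: the dual character of `b_0`, first factor
      obtain ⟨χ, -, hχb, hχc⟩ := exists_handleCuspCharacter (g := g) (r := r + 2) (n := 3) (fun _ => 0)
        (fun i => if i = ⟨0, hg⟩ then 1 else 0) (fun _ => 0) (by simp)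
      refine ⟨(MonoidHom.inl _ _).comp χ, ?_, ?_⟩
      · rw [MonoidHom.comp_apply, hxc, hχc, ofAdd_zero, map_one]
      · rw [MonoidHom.comp_apply, hxn, hχb, if_pos rfl, Ne, hinl]
        exact ofAdd_one_ne_one₃''
    · -- alive cusp `c_{k₁}`, killed node: `δ_{k₁} − δ_m`, first factor
      set k₁ := e c₁ with hk₁
      obtain ⟨m, hm⟩ := exists_ne'' (by omega : 2 ≤ r + 2) k₁
      obtain ⟨χ, -, hχb, hχc⟩ := exists_handleCuspCharacter (g := g) (r := r + 2) (n := 3) (fun _ => 0)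
        (fun _ => 0) (fun j => (if j = k₁ then (1 : ZMod 3) else 0) + (if j = m then (-1 : ZMod 3) else 0))
        (sum_twoDelta k₁ m)
      refine ⟨(MonoidHom.inl _ _).comp χ, ?_, ?_⟩
      · rw [MonoidHom.comp_apply, hxn, hχb, ofAdd_zero, map_one]
      · rw [MonoidHom.comp_apply, hxc, hχc, if_pos rfl, if_neg (Ne.symm hm), add_zero, Ne, hinl]
        exact ofAdd_one_ne_one₃''
    · -- alive cusp `c_{k₁}`, killed cusp `c_{k₂}`: the non-abelian cusp character, second factor
      set k₁ := e c₁ with hk₁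
      set k₂ := e c₂ with hk₂
      have hk : k₂ ≠ k₁ := fun h => hne12 (by rw [e.injective h.symm])
      obtain ⟨ρ, hρ₁, hρ₂⟩ := exists_nonabelian_cuspCharacter (n := r + 2) hg k₁
      refine ⟨(MonoidHom.inr _ _).comp ρ, ?_, ?_⟩
      · rw [MonoidHom.comp_apply, hxc, hρ₂ k₂ hk, map_one]
      · rw [MonoidHom.comp_apply, hxc, Ne, hinr]
        exact hρ₁
  exact edgeLikeSeparatingCoverings_of_rankOneFreeFactors hι hSig G xs hx hfac hsep

/-! ### F-2829 and Prop. 1.2 (i)(ii) with two cusps -/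

/-- **F-2829 (`SeparatingCoverings`, all three conjuncts) at EVERY irreducible one-nodal datum with `g ≥ 1`
and at least TWO cusps** (F-2826 from the parent file — `1 ≤ r + 1` —, F-2827 above, the `Π^unr` third
abc-iut-f-164's). [cite: MochizukiCombGC2007, Prop 1.2 proof p.9] -/
theorem separatingCoverings_of_irreducibleNodal_twoCusps (hne : Sigma.Nonempty)
    (hprime : ∀ p ∈ Sigma, p.Prime) (ι : PuncturedSurfaceGroup g (r + 2) →* P)
    (hι : IsProSigmaCompletion Sigma ι) (G : PSCDatum P) (hg : 1 ≤ g)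
    (e : G.graph.C ≃ Fin (r + 2))
    (hC : ∀ c', G.cuspGp c' = ((cuspInertia (g := g) (e c')).map ι).topologicalClosure)
    (v₀ : G.graph.V) (hV : ∀ w, w = v₀) (n₀ : G.graph.N) (hN : ∀ n, n = n₀)
    (hE : G.nodeGp n₀ = ((Subgroup.zpowers (PuncturedSurfaceGroup.b (r := r + 2) (⟨0, hg⟩ : Fin g))).map
      ι).topologicalClosure)
    (hV₀ : G.vertGp v₀ = ((Subgroup.closure {x : PuncturedSurfaceGroup g (r + 2) |
        x = PuncturedSurfaceGroup.b ⟨0, hg⟩ ∨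
        x = PuncturedSurfaceGroup.a ⟨0, hg⟩ * PuncturedSurfaceGroup.b ⟨0, hg⟩ *
          (PuncturedSurfaceGroup.a ⟨0, hg⟩)⁻¹ ∨
        (∃ i : Fin g, 1 ≤ (i : ℕ) ∧ (x = PuncturedSurfaceGroup.a i ∨ x = PuncturedSurfaceGroup.b i)) ∨
        ∃ j : Fin (r + 2), x = PuncturedSurfaceGroup.c j}).map ι).topologicalClosure)
    (hgen : G.genus v₀ = g - 1) : G.SeparatingCoverings :=
  ⟨G.verticialSeparatingCoverings_of_irreducibleNodal_affine hne hprime ι hι hg (Or.inr (by omega)) v₀ hV hV₀,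
    G.edgeLikeSeparatingCoverings_of_irreducibleNodal_twoCusps hne hprime ι hι hg e hC n₀ hN hE,
    G.unrVerticialSeparatingCoverings_of_irreducibleNodal hne hprime ι hι hg e hC v₀ hV n₀ hN hE hV₀ hgen⟩

/-- **[CombGC] Prop. 1.2 (i) and (ii), ALL FIVE typed clauses, at EVERY irreducible one-nodal datum with
`g ≥ 1` and at least TWO cusps** — abc-iut-w5-d183's `prop12_of_separating` on
`separatingCoverings_of_irreducibleNodal_twoCusps`. [cite: MochizukiCombGC2007, Prop 1.2 pp.8-9] -/
theorem prop12_of_irreducibleNodal_twoCusps (hne : Sigma.Nonempty)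
    (hprime : ∀ p ∈ Sigma, p.Prime) (ι : PuncturedSurfaceGroup g (r + 2) →* P)
    (hι : IsProSigmaCompletion Sigma ι) (G : PSCDatum P) (hg : 1 ≤ g)
    (e : G.graph.C ≃ Fin (r + 2))
    (hC : ∀ c', G.cuspGp c' = ((cuspInertia (g := g) (e c')).map ι).topologicalClosure)
    (v₀ : G.graph.V) (hV : ∀ w, w = v₀) (n₀ : G.graph.N) (hN : ∀ n, n = n₀)
    (hE : G.nodeGp n₀ = ((Subgroup.zpowers (PuncturedSurfaceGroup.b (r := r + 2) (⟨0, hg⟩ : Fin g))).map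
      ι).topologicalClosure)
    (hV₀ : G.vertGp v₀ = ((Subgroup.closure {x : PuncturedSurfaceGroup g (r + 2) |
        x = PuncturedSurfaceGroup.b ⟨0, hg⟩ ∨
        x = PuncturedSurfaceGroup.a ⟨0, hg⟩ * PuncturedSurfaceGroup.b ⟨0, hg⟩ *
          (PuncturedSurfaceGroup.a ⟨0, hg⟩)⁻¹ ∨
        (∃ i : Fin g, 1 ≤ (i : ℕ) ∧ (x = PuncturedSurfaceGroup.a i ∨ x = PuncturedSurfaceGroup.b i)) ∨
        ∃ j : Fin (r + 2), x = PuncturedSurfaceGroup.c j}).map ι).topologicalClosure)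
    (hgen : G.genus v₀ = g - 1) :
    (G.VerticialOpenInterDeterminesVertex ∧ G.EdgeLikeOpenInterDeterminesEdge ∧
      G.UnrVerticialOpenInterDeterminesVertex) ∧
    (G.VerticialEdgeLikeCommensurablyTerminal ∧ G.UnrVerticialCommensurablyTerminal) :=
  G.prop12_of_separating
    (G.separatingCoverings_of_irreducibleNodal_twoCusps hne hprime ι hι hg e hC v₀ hV n₀ hN hE hV₀ hgen)

/-- **Non-vacuity at a genuine datum with exactly two cusps**: over any nonempty set of primes `Σ` the pro-`Σ`
datum of `Γ_{1,2}` of `PSCIrreducibleNodalOrigin.lean` (`g = 1`) satisfies F-2829 and all five clauses of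
Prop. 1.2 (i)(ii). [cite: MochizukiCombGC2007, Prop 1.2 pp.8-9] -/
theorem exists_irreducibleNodalDatum_prop12_twoCusps (Sigma : Set ℕ) (hne : Sigma.Nonempty)
    (hprime : ∀ p ∈ Sigma, p.Prime) :
    ∃ (Q : ProfiniteGrp.{0}) (ι : PuncturedSurfaceGroup 1 2 →* Q) (G : PSCDatum Q),
      IsProSigmaCompletion Sigma ι ∧ G.Sigma = Sigma ∧ G.graph.i = 1 ∧ G.graph.n = 1 ∧ G.graph.r = 2 ∧
      G.SeparatingCoverings ∧
      (G.VerticialOpenInterDeterminesVertex ∧ G.EdgeLikeOpenInterDeterminesEdge ∧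
        G.UnrVerticialOpenInterDeterminesVertex) ∧
      (G.VerticialEdgeLikeCommensurablyTerminal ∧ G.UnrVerticialCommensurablyTerminal) := by
  obtain ⟨Q, ι, G, e, v₀, n₀, hι, hS, hi, hn, hr, hC, hV, hN, hE, hV₀, hgen, -⟩ :=
    exists_irreducibleNodalDatum Sigma hne hprime 1 2 le_rfl
  have hsep := G.separatingCoverings_of_irreducibleNodal_twoCusps hne hprime ι hι le_rfl e hC v₀ hV n₀
    hN hE hV₀ hgen
  exact ⟨Q, ι, G, hι, hS, hi, hn, hr, hsep, G.prop12_of_separating hsep⟩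

end PSCDatum

end Literature.AnabelianGeometry.SemiGraphs

end
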